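import Literature.NumberTheory.QuadraticFields.ReducedFormOfSplitNumber
import Literature.NumberTheory.Sieve.SmoothNumbersRestrictedPrimes
import HarnessLib

/-!
# Smooth split numbers inject into reduced forms (Lenstra–Pomerance, towards Theorem 8.1)

Lenstra–Pomerance, *A rigorous time bound for factoring integers*, J. Amer. Math. Soc. **5**
(1992): in the proof of Theorem 8.1 (p. 503) the `y`-smooth elements of the class group `C_Δ`
are bounded below by the number `ψ(½√|Δ|, y; 𝒫_Δ)` of integers `a ≤ ½√|Δ|` composed of primes
`p ≤ y` of `𝒫_Δ`, via Lemma 2.10 (each such `a` is the first coefficient of a reduced form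
`(a, b, c) ∈ C_Δ`). `card_factoredUpTo_le_card_reducedForms_filter` records exactly this
injection for the tree's objects: for a finite set `Q` of odd primes `p ∤ Δ` modulo which `Δ` is a
square, and `X` with `4X² ≤ −Δ`,

  `ψ(X; Q) = #(factoredUpTo Q X) ≤ #{F ∈ reducedForms Δ : F.1 ∈ factoredUpTo Q X}`,

where `factoredUpTo Q X` (`Literature/NumberTheory/Sieve/SmoothNumbersRestrictedPrimes.lean`) is
the set counted by Theorem 6.1 (`Literature.NumberTheory.Sieve.card_factoredUpTo_ge`) and
`reducedForms Δ` is the tree's set of reduced primitive positive definite forms (Cox §2.A).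
Everything is proved.

## References

* H. W. Lenstra Jr., C. Pomerance, J. Amer. Math. Soc. 5 (1992) 483–516, Lemma 2.10 and the
  proof of Theorem 8.1. [LenstraPomerance1992]
-/

namespace Literature.NumberTheory.QuadraticFields.BinaryQuadraticForm

open Finset Literature.NumberTheory.Sieve

/-- A positive integer all of whose prime factors are odd is odd. [folklore] -/
theorem odd_of_mem_factoredNumbers {Q : Finset ℕ} (hQ : ∀ p ∈ Q, p ≠ 2) {n : ℕ}
    (hn : n ∈ Nat.factoredNumbers Q) : Odd n := by
  rw [Nat.odd_iff]
  by_contra h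
  have h2 : 2 ∣ n := Nat.dvd_of_mod_eq_zero (by omega)
  have hmem := (Nat.mem_factoredNumbers'.1 hn) 2 Nat.prime_two h2
  exact hQ 2 hmem rfl

/-- **Smooth split numbers give reduced forms** [LP92, proof of Thm 8.1 via Lemma 2.10]. Let
`Δ < 0`, `Δ ≡ 0, 1 (mod 4)`, `Q` a finite set of odd primes `p ∤ Δ` modulo which `Δ` is a square
(`Q ⊆ 𝒫_Δ`), and `4X² ≤ −Δ`. Then the number `ψ(X; Q)` of integers `1 ≤ a ≤ X` composed of primes
of `Q` is at most the number of reduced primitive positive definite forms of discriminant `Δ`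
whose first coefficient is such an `a` — in particular at most `h(Δ)`.
[cite: LenstraPomerance1992, §8 proof of Thm 8.1 (with Lemma 2.10)] -/
theorem card_factoredUpTo_le_card_reducedForms_filter {Δ : ℤ} (hΔ : Δ < 0)
    (hΔ4 : Δ % 4 = 0 ∨ Δ % 4 = 1) {Q : Finset ℕ}
    (hQ : ∀ p ∈ Q, p.Prime ∧ p ≠ 2 ∧ ¬ (p : ℤ) ∣ Δ ∧ IsSquare (Δ : ZMod p)) {X : ℕ}
    (hX : 4 * (X : ℤ) ^ 2 ≤ -Δ) :
    #(factoredUpTo Q X) ≤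
      #((reducedForms Δ).filter fun F => F.1.toNat ∈ factoredUpTo Q X) := by
  refine card_le_card_of_surjOn (fun F : ℤ × ℤ × ℤ => F.1.toNat) fun a ha => ?_
  obtain ⟨haX, haQ⟩ := mem_factoredUpTo.1 (mem_coe.1 ha)
  have ha0 : 0 < a := Nat.pos_of_ne_zero haQ.1
  have hodd : Odd a := odd_of_mem_factoredNumbers (fun p hp => (hQ p hp).2.1) haQ
  have hsize : 4 * (a : ℤ) ^ 2 ≤ -Δ := by
    have : (a : ℤ) ≤ X := by exact_mod_cast haX
    nlinarith
  have hsplit : ∀ p ∈ a.primeFactors, ¬ (p : ℤ) ∣ Δ ∧ IsSquare (Δ : ZMod p) := by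
    intro p hp
    have hpQ : p ∈ Q := Nat.primeFactors_subset_of_mem_factoredNumbers haQ hp
    exact ⟨(hQ p hpQ).2.2.1, (hQ p hpQ).2.2.2⟩
  obtain ⟨b, c, hF⟩ := exists_mem_reducedForms_of_split hΔ hΔ4 hodd hsize hsplit
  refine ⟨((a : ℤ), b, c), ?_, by simp⟩
  rw [mem_coe, mem_filter]
  exact ⟨hF, by simpa using mem_coe.1 ha⟩

/-- Hence `ψ(X; Q) ≤ h(Δ)` under the same hypotheses. [cite: LenstraPomerance1992, §8 proof of Thm 8.1] -/
theorem card_factoredUpTo_le_classNumber {Δ : ℤ} (hΔ : Δ < 0) (hΔ4 : Δ % 4 = 0 ∨ Δ % 4 = 1)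
    {Q : Finset ℕ} (hQ : ∀ p ∈ Q, p.Prime ∧ p ≠ 2 ∧ ¬ (p : ℤ) ∣ Δ ∧ IsSquare (Δ : ZMod p))
    {X : ℕ} (hX : 4 * (X : ℤ) ^ 2 ≤ -Δ) : #(factoredUpTo Q X) ≤ classNumber Δ :=
  (card_factoredUpTo_le_card_reducedForms_filter hΔ hΔ4 hQ hX).trans (card_filter_le _ _)

end Literature.NumberTheory.QuadraticFields.BinaryQuadraticForm
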